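/-
Copyright (c) 2026 the pub-hodgecm-mathlib formalisation cell (harness21).  Prover seat hodgecm-mathlib-A-p19 (g20), topic T5 = P8
«(C♯)hol interior», node C∞ brick (W1) «phase of Folland's section at a sign-block-diagonal one-place element of an INDEFINITE place»
(census 2026-08-31T23:10Z; lead B-p18 (g29)).  KERNEL: theorems only.
-/
import Literature.NumberTheory.GelbartRogawski1991.DoubledWeilRepresentationArchPlacePhase
import HarnessLib

/-!
# The phase map of Folland's section at the one-place element `k_{v₀,u}` of a SIGN-BLOCK-DIAGONAL `u ∈ U(V_{w(v₀)})`, any signature: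
# `placeBlock (δ_{v₀} ↦ ((W_u) ⊕ 1)^{e₂})`, `W_u = (ū₊ ⊕ u₋)` in the scaled frame ([Folland1989, Prop. (4.39)]; [KonnoKonno2007, §3.1])

Topic `NumberTheory/GelbartRogawski1991` (T5 = P8 «(C♯)hol interior», node C∞, brick (W1)); namespaces `Literature.NumberTheory.Weil1964` (§1, a
generic unitary-block lemma) and `Literature.NumberTheory.GelbartRogawski1991.GRConstruction` (§2–§3).  KERNEL ONLY: proved theorems; 0 definitions,
0 records, 0 `sorry`.

★ `exists_proj_sectionD_archKPlace_eq_placeBlock_of_pos` (brick β-I of node Cc) reads Folland's section at `k_{v₀,u} = ((u at w(v₀)) ⊗ 1_W) ⊕ 1` when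
the pair form is POSITIVE at `v₀` (every `u ∈ U(V_{w(v₀)})` qualifies, the place being definite).  At the INDEFINITE place `w(ι)` of node C∞
([Liu2021, Lem. D.2 (2)]) the pair form `diag dV ⊗ ⟨a⟩` has signature `(2,1)` or `(1,2)`, and only the elements `u` of the block-compact subgroup
`U(V₊) × U(V₋)` — those whose scaled-frame matrix has NO ENTRY ACROSS THE TWO SIGN CLASSES — are sign-block compact in the sense of ★ brick (i)
(`exists_archUFormPi_eq_kV_of_sign_separated`).  For them the same reading holds, with the positive block CONJUGATED and the negative block not
(★ `coe_dualPairι` ∕ ★ `proj_archWeilSectionS_eq_realifySp_placeBlock`):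

* §1 (private) `Weil1964.submatrix_mem_unitaryGroup_of_apply_eq_zero` — a unitary matrix on `ι ≃ α ⊕ β` whose `(α, β)`-entries vanish has a unitary
  `(α, α)`-block (generic);
* §2 `archAt_archKPlace_sign_separated_of_blockDiag`, `exists_archUFormPi_archKPlace_eq_kV_of_blockDiag` — every place component of `k_{v₀,u}` is
  sign-separated as soon as the `e`-reindexed matrix of `u ⊗ 1_W` has no entry across the sign classes of the pair sign vector at `v₀` (at `v ≠ v₀`
  the component is `1`; the second copy is `1`);
* §3 **`exists_proj_sectionD_archKPlace_eq_placeBlock_of_blockDiag`** — for such `u` there is `W ∈ U(n)` with ENTRIES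
  `W i i′ = star (D_i R_{i i′} D_{i′}⁻¹)` if `0 < x_{v₀,i}` and `W i i′ = D_i R_{i i′} D_{i′}⁻¹` otherwise (`R = reindex e e (u ⊗ 1_W)`, `D = √|x_{v₀}|`;
  across the sign classes both read `0`) such that `proj (sectionD k_{v₀,u}) = realifySp (placeBlock (Pi.mulSingle v₀ ((W ⊕ 1)^{e₂⁻¹})))`, and
  **`exists_sectionD_archKPlace_apply_of_blockDiag`** — `sectionD k_{v₀,u}` acts by `vac • μ₀(placeBlock (Pi.mulSingle v₀ ((W ⊕ 1)^{e₂⁻¹})))`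
  (★ `MpS.apply_eq_vac_smul_unitaryOpPi`).  With ALL signs positive at `v₀` this is ★ β-I (`W = ū` scaled); with all signs negative, ★ β-I-neg
  (`W = u` scaled); the mixed case is the input of node C∞'s closer (the `K′ = U(V₊) × U(V₋)`-covariance of the theta functional at `w(ι)`, to be
  compared with the `K_∞`-type of holomorphic cotangent forms, ★ `Liu2021/ThetaLiftFromLineEquivariantFunctional`).

HONEST SCOPE.  Statements about the tree's own Weil-representation terms; nothing of [Liu2021] is asserted; the vacuum coefficient and the splitting
character `η` at such `u` (brick (W2)) are NOT computed here.  HC_CM is NOT proved here or anywhere in the tree.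

References: [Folland1989] G. B. Folland, *Harmonic Analysis in Phase Space* (1989), §4.2 Prop. (4.39); [Weil1964] A. Weil, Acta Math. 111 (1964),
Chap. III n° 37; [KonnoKonno2007] K. Konno, T. Konno, Kyushu J. Math. 61 (2007), §3.1 (3.1), Lemma 5.2; [BorelJacquet1979] §4.1; [Liu2021] App. D
Lem. D.2 (2) (the consumer).
-/

set_option autoImplicit false

noncomputable section

open scoped Matrix Kronecker

/-! ## §1 A unitary with vanishing cross entries has unitary diagonal blocks (generic) -/

namespace Literature.NumberTheory.Weil1964

/-- **A unitary matrix on `ι ≃ α ⊕ β` whose `(α, β)`-entries vanish has a unitary `(α, α)`-block**: if `U ∈ U(ι)` and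
`U (ε (inl a)) (ε (inr b)) = 0` for all `a, b`, then `(a, a′) ↦ U (ε (inl a)) (ε (inl a′))` is in `U(α)` (`A Aᴴ = 1` is the `(inl, inl)`-block of
`U Uᴴ = 1`, the cross terms being absent). [folklore] -/
private theorem submatrix_mem_unitaryGroup_of_apply_eq_zero {ι α β : Type} [Fintype ι] [DecidableEq ι] [Fintype α] [DecidableEq α] [Fintype β]
    [DecidableEq β] (U : Matrix.unitaryGroup ι ℂ) (ε : α ⊕ β ≃ ι)
    (h : ∀ (a : α) (b : β), (U : Matrix ι ι ℂ) (ε (Sum.inl a)) (ε (Sum.inr b)) = 0) :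
    (Matrix.of fun a a' : α => (U : Matrix ι ι ℂ) (ε (Sum.inl a)) (ε (Sum.inl a'))) ∈ Matrix.unitaryGroup α ℂ := by
  rw [Matrix.mem_unitaryGroup_iff]
  have hU : (U : Matrix ι ι ℂ) * star (U : Matrix ι ι ℂ) = 1 := Matrix.mem_unitaryGroup_iff.mp U.2
  ext a a'
  have hentry := congrArg (fun M : Matrix ι ι ℂ => M (ε (Sum.inl a)) (ε (Sum.inl a'))) hU
  simp only [Matrix.mul_apply, Matrix.star_eq_conjTranspose, Matrix.conjTranspose_apply] at hentry
  rw [← Equiv.sum_comp ε, Fintype.sum_sum_type] at hentry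
  simp only [h, zero_mul, Finset.sum_const_zero, add_zero, Matrix.one_apply, EmbeddingLike.apply_eq_iff_eq, Sum.inl.injEq] at hentry
  simp only [Matrix.mul_apply, Matrix.star_eq_conjTranspose, Matrix.conjTranspose_apply, Matrix.of_apply, Matrix.one_apply]
  convert hentry using 1

end Literature.NumberTheory.Weil1964

/-! ## §2 The place components of `k_{v₀,u}` are sign-separated for a sign-block-diagonal `u` -/

namespace Literature.NumberTheory.GelbartRogawski1991.GRConstruction

open scoped Classical TensorProduct SchwartzMap
open NumberField NumberField.InfinitePlace NumberField.mixedEmbedding IsDedekindDomain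
open Literature.RepresentationTheory.HeisenbergGroup
open Literature.NumberTheory.Automorphic Literature.NumberTheory.Automorphic.UnitaryGroup
open Literature.NumberTheory.Weil1964
open Literature.Analysis.SegalBargmann
open Literature.RepresentationTheory.KonnoKonno2007 Literature.RepresentationTheory.KonnoKonno2007.RealDualPair
open UnitaryDualPair UnitaryDualPair.ArchSplitting
open Literature.NumberTheory.GelbartRogawski1991.UnitaryDualPair.LocalSplitting

variable (L : Type) [Field L] [NumberField L] [IsCMField L]

variable {N M n : ℕ} (e : Fin N × Fin M ≃ Fin n)
  (dV : Fin N → L) (hdV : ∀ i, IsCMField.complexConj L (dV i) = dV i) (hdV0 : ∀ i, dV i ≠ 0)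
  (dW : Fin M → L) (hdW : ∀ i, IsCMField.complexConj L (dW i) = dW i) (hdW0 : ∀ i, dW i ≠ 0)
  (v₀ : {v : InfinitePlace (Fp L) // v.IsReal})

/-- **every place component of `k_{v₀,u}` is SIGN-SEPARATED when `u` is sign-block-diagonal at `v₀`**: if the `e`-reindexed matrix of `u ⊗ 1_W`
has no entry across the two sign classes of the pair sign vector at `v₀`, then at `v = v₀` the component `(u ⊗ 1_W) ⊕ 1` has no entry across the sign
classes of the doubled sign vector, and at `v ≠ v₀` it is `1` (the hypothesis `hsep` of ★ `exists_archUFormPi_eq_kV_of_sign_separated` for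
`g = k_{v₀,u}`; ★ `archAt_archKPlace_sign_separated` is the definite case, where the hypothesis is empty). [cite: Folland1989, §4.2 Prop. (4.39)]
[cite: KonnoKonno2007, §3.1] -/
theorem archAt_archKPlace_sign_separated_of_blockDiag (u : UnitaryGroup.archLocal L N (Matrix.diagonal dV) (cmPlaceOver L v₀))
    (hblk : ∀ k k' : Fin n, 0 < signVec (cmPlaceOver L) (cmGramEntry L e dV hdV dW hdW) (imagUnit L) v₀ k →
      ¬ 0 < signVec (cmPlaceOver L) (cmGramEntry L e dV hdV dW hdW) (imagUnit L) v₀ k' →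
      Matrix.reindex e e
          ((((u : UnitaryGroup.archLocal L N (Matrix.diagonal dV) (cmPlaceOver L v₀)) : GL (Fin N) ℂ) : Matrix (Fin N) (Fin N) ℂ) ⊗ₖ
            (1 : Matrix (Fin M) (Fin M) ℂ)) k k' = 0 ∧
      Matrix.reindex e e
          ((((u : UnitaryGroup.archLocal L N (Matrix.diagonal dV) (cmPlaceOver L v₀)) : GL (Fin N) ℂ) : Matrix (Fin N) (Fin N) ℂ) ⊗ₖ
            (1 : Matrix (Fin M) (Fin M) ℂ)) k' k = 0)
    (v : {v : InfinitePlace (Fp L) // v.IsReal}) :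
    ∀ k k' : Fin (n + n), 0 < signVec (cmPlaceOver L) (entryD L e dV hdV dW hdW) (imagUnit L) v k →
      ¬ 0 < signVec (cmPlaceOver L) (entryD L e dV hdV dW hdW) (imagUnit L) v k' →
      (((UnitaryGroup.archAt (Fp L) L (IsCMField.complexConj L) (n + n) (hermD L e dV hdV dW hdW) (cmPlaceOver L v) (cmPlaceOver_smul L v)
          (IsCMField.complexConj_ne_one L) (archKPlace L e dV hdV dW hdW v₀ u) :
          UnitaryGroup.archLocal L (n + n) (hermD L e dV hdV dW hdW) (cmPlaceOver L v)) : GL (Fin (n + n)) ℂ) :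
          Matrix (Fin (n + n)) (Fin (n + n)) ℂ) k k' = 0 ∧
      (((UnitaryGroup.archAt (Fp L) L (IsCMField.complexConj L) (n + n) (hermD L e dV hdV dW hdW) (cmPlaceOver L v) (cmPlaceOver_smul L v)
          (IsCMField.complexConj_ne_one L) (archKPlace L e dV hdV dW hdW v₀ u) :
          UnitaryGroup.archLocal L (n + n) (hermD L e dV hdV dW hdW) (cmPlaceOver L v)) : GL (Fin (n + n)) ℂ) :
          Matrix (Fin (n + n)) (Fin (n + n)) ℂ) k' k = 0 := by
  intro k k' hk hk'
  have hkk' : k ≠ k' := fun h => hk' (h ▸ hk)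
  rw [coe_archAt_archKPlace]
  obtain ⟨x, rfl⟩ := (e₂ (n := n)).surjective k
  obtain ⟨y, rfl⟩ := (e₂ (n := n)).surjective k'
  simp only [Matrix.reindex_apply, Matrix.submatrix_apply, Equiv.symm_apply_apply]
  rcases x with a | a <;> rcases y with b | b
  · -- both in the first copy: at `v₀` by the block hypothesis; at `v ≠ v₀` the block is `1 ⊗ 1`
    rw [signVec_doubled_inl] at hk hk'
    by_cases hv : v = v₀
    · subst hv
      have h1 := UnitaryGroup.archAt_archSingle_self (Fp L) L (IsCMField.complexConj L) N (Matrix.diagonal dV)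
        (IsCMField.complexConj_ne_one L) (complexConj_smul_infinitePlace L) (cmPlaceOver L v) u
      erw [h1]
      simp only [Matrix.fromBlocks_apply₁₁]
      have h := hblk a b hk hk'
      simp only [Matrix.reindex_apply, Matrix.submatrix_apply] at h
      exact h
    · have hne : cmPlaceOver L v ≠ cmPlaceOver L v₀ := fun h => hv (Subtype.ext (by
        rw [← cmPlaceOver_comap L v, ← cmPlaceOver_comap L v₀, h]))
      have hab : a ≠ b := fun h => hkk' (by rw [h])
      have h1 := UnitaryGroup.archAt_archSingle_of_ne (Fp L) L (IsCMField.complexConj L) N (Matrix.diagonal dV)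
        (IsCMField.complexConj_ne_one L) (complexConj_smul_infinitePlace L) (cmPlaceOver L v₀) hne u
      erw [h1]
      simp only [Matrix.fromBlocks_apply₁₁, Matrix.submatrix_apply, OneMemClass.coe_one, Units.val_one,
        Matrix.one_kronecker_one, Matrix.one_apply, e.symm.injective.eq_iff, hab, hab.symm, if_false, and_self]
  · simp only [Matrix.fromBlocks_apply₁₂, Matrix.fromBlocks_apply₂₁, Matrix.zero_apply, and_self]
  · simp only [Matrix.fromBlocks_apply₁₂, Matrix.fromBlocks_apply₂₁, Matrix.zero_apply, and_self]
  · have hab : a ≠ b := fun h => hkk' (by rw [h])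
    simp only [Matrix.fromBlocks_apply₂₂, Matrix.one_apply, hab, hab.symm, if_false, and_self]

include hdV0 hdW0 in
/-- **`archUFormPi (k_{v₀,u}) v = kV (a_v, b_v)` at every real place `v`** for a sign-block-diagonal `u` (★ brick (i)
`exists_archUFormPi_eq_kV_of_sign_separated` + `archAt_archKPlace_sign_separated_of_blockDiag`). [cite: Folland1989, §4.2 Prop. (4.39)] [cite: KonnoKonno2007, §3.1] -/
theorem exists_archUFormPi_archKPlace_eq_kV_of_blockDiag (u : UnitaryGroup.archLocal L N (Matrix.diagonal dV) (cmPlaceOver L v₀))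
    (hblk : ∀ k k' : Fin n, 0 < signVec (cmPlaceOver L) (cmGramEntry L e dV hdV dW hdW) (imagUnit L) v₀ k →
      ¬ 0 < signVec (cmPlaceOver L) (cmGramEntry L e dV hdV dW hdW) (imagUnit L) v₀ k' →
      Matrix.reindex e e
          ((((u : UnitaryGroup.archLocal L N (Matrix.diagonal dV) (cmPlaceOver L v₀)) : GL (Fin N) ℂ) : Matrix (Fin N) (Fin N) ℂ) ⊗ₖ
            (1 : Matrix (Fin M) (Fin M) ℂ)) k k' = 0 ∧
      Matrix.reindex e e
          ((((u : UnitaryGroup.archLocal L N (Matrix.diagonal dV) (cmPlaceOver L v₀)) : GL (Fin N) ℂ) : Matrix (Fin N) (Fin N) ℂ) ⊗ₖ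
            (1 : Matrix (Fin M) (Fin M) ℂ)) k' k = 0)
    (v : {v : InfinitePlace (Fp L) // v.IsReal}) :
    ∃ k : Matrix.unitaryGroup (PosIdx (signVec (cmPlaceOver L) (entryD L e dV hdV dW hdW) (imagUnit L) v)) ℂ ×
        Matrix.unitaryGroup (NegIdx (signVec (cmPlaceOver L) (entryD L e dV hdV dW hdW) (imagUnit L) v)) ℂ,
      archUFormPi L (IsCMField.complexConj L) (n + n) (IsCMField.complexConj_ne_one L) (cmPlaceOver L) (cmPlaceOver_smul L)
          (cmPlaceOver_comap L) (entryD L e dV hdV dW hdW) (gramD_gram_realDiagonal_entry_ne_zero L e dV hdV dW hdW hdV0 hdW0)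
          (gramD_eq_diagonal_cm L e dV hdV dW hdW) (J := hermD L e dV hdV dW hdW) rfl (complexConj_imagUnit L) (imagUnit_ne_zero L)
          (archKPlace L e dV hdV dW hdW v₀ u) v =
        UForm.kV _ _ k :=
  (exists_archUFormPi_eq_kV_of_sign_separated L (IsCMField.complexConj L) (n + n) (IsCMField.complexConj_ne_one L)
    (cmPlaceOver L) (cmPlaceOver_smul L) (cmPlaceOver_comap L) (entryD L e dV hdV dW hdW)
    (gramD_gram_realDiagonal_entry_ne_zero L e dV hdV dW hdW hdV0 hdW0) (gramD_eq_diagonal_cm L e dV hdV dW hdW)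
    (J := hermD L e dV hdV dW hdW) rfl
    (complexConj_imagUnit L) (imagUnit_ne_zero L) (archKPlace L e dV hdV dW hdW v₀ u) v
    (archAt_archKPlace_sign_separated_of_blockDiag L e dV hdV dW hdW v₀ u hblk v)).imp fun _ hk => hk.1

/-! ## §3 The phase of Folland's section at `k_{v₀,u}` for a sign-block-diagonal `u`, any signature at `v₀` -/

set_option maxHeartbeats 2000000 in
-- (entry bookkeeping through `archUFormPi`/`kV`/`signSplit`/`e₂` at every real place and in both sign classes; one `simp` per sign case)
/-- **THE PHASE OF FOLLAND'S SECTION AT `k_{v₀,u}`, `u` SIGN-BLOCK-DIAGONAL, ANY SIGNATURE at `v₀`**: there is `W ∈ U(n)` with entries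
`W i i′ = star (D_i · R_{i i′} · D_{i′}⁻¹)` for `0 < x_{v₀,i}` and `W i i′ = D_i · R_{i i′} · D_{i′}⁻¹` otherwise (`R = e-reindex (u ⊗ 1_W)`, `D = √|x_{v₀}|` the
scale of `frameV`; both read `0` across the sign classes) such that `proj (sectionD k_{v₀,u}) = realifySp (placeBlock (Pi.mulSingle v₀ ((W ⊕ 1)^{e₂⁻¹})))`
— at `v₀` the first copy moves by the CONJUGATE of the scaled positive block and by the scaled negative block itself (★ `coe_dualPairι`), the second copy is
fixed; every other real place is fixed. [cite: Folland1989, §4.2 Prop. (4.39)] [cite: KonnoKonno2007, §3.1 (3.1), Lemma 5.2 p. 73] [cite: BorelJacquet1979, §4.1] -/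
theorem exists_proj_sectionD_archKPlace_eq_placeBlock_of_blockDiag (u : UnitaryGroup.archLocal L N (Matrix.diagonal dV) (cmPlaceOver L v₀))
    (hblk : ∀ k k' : Fin n, 0 < signVec (cmPlaceOver L) (cmGramEntry L e dV hdV dW hdW) (imagUnit L) v₀ k →
      ¬ 0 < signVec (cmPlaceOver L) (cmGramEntry L e dV hdV dW hdW) (imagUnit L) v₀ k' →
      Matrix.reindex e e
          ((((u : UnitaryGroup.archLocal L N (Matrix.diagonal dV) (cmPlaceOver L v₀)) : GL (Fin N) ℂ) : Matrix (Fin N) (Fin N) ℂ) ⊗ₖ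
            (1 : Matrix (Fin M) (Fin M) ℂ)) k k' = 0 ∧
      Matrix.reindex e e
          ((((u : UnitaryGroup.archLocal L N (Matrix.diagonal dV) (cmPlaceOver L v₀)) : GL (Fin N) ℂ) : Matrix (Fin N) (Fin N) ℂ) ⊗ₖ
            (1 : Matrix (Fin M) (Fin M) ℂ)) k' k = 0) :
    ∃ W : Matrix.unitaryGroup (Fin n) ℂ,
      (∀ i i' : Fin n, (W : Matrix (Fin n) (Fin n) ℂ) i i' =
        if 0 < signVec (cmPlaceOver L) (cmGramEntry L e dV hdV dW hdW) (imagUnit L) v₀ i then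
          star ((((sqrtAbs (signVec (cmPlaceOver L) (cmGramEntry L e dV hdV dW hdW) (imagUnit L) v₀) i : ℝ) : ℂ)) *
            Matrix.reindex e e
              ((((u : UnitaryGroup.archLocal L N (Matrix.diagonal dV) (cmPlaceOver L v₀)) : GL (Fin N) ℂ) : Matrix (Fin N) (Fin N) ℂ) ⊗ₖ
                (1 : Matrix (Fin M) (Fin M) ℂ)) i i' *
            (((sqrtAbs (signVec (cmPlaceOver L) (cmGramEntry L e dV hdV dW hdW) (imagUnit L) v₀) i' : ℝ) : ℂ))⁻¹)
        else
          (((sqrtAbs (signVec (cmPlaceOver L) (cmGramEntry L e dV hdV dW hdW) (imagUnit L) v₀) i : ℝ) : ℂ)) *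
            Matrix.reindex e e
              ((((u : UnitaryGroup.archLocal L N (Matrix.diagonal dV) (cmPlaceOver L v₀)) : GL (Fin N) ℂ) : Matrix (Fin N) (Fin N) ℂ) ⊗ₖ
                (1 : Matrix (Fin M) (Fin M) ℂ)) i i' *
            (((sqrtAbs (signVec (cmPlaceOver L) (cmGramEntry L e dV hdV dW hdW) (imagUnit L) v₀) i' : ℝ) : ℂ))⁻¹) ∧
      MpS.proj (sectionD L e dV hdV hdV0 dW hdW hdW0 (archKPlace L e dV hdV dW hdW v₀ u)) =
        realifySp _ (placeBlock (Pi.mulSingle v₀ (reindexUnitary (e₂ (n := n)).symm (blockU (W, 1))))) := by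
  choose k hk using exists_archUFormPi_archKPlace_eq_kV_of_blockDiag L e dV hdV hdV0 dW hdW hdW0 v₀ u hblk
  -- the sign-frame component at `v` in coordinates: `(fromBlocks k₁ 0 0 k₂) (ε x) (ε y) = D_x · (k_{v₀,u})_{w(v)} x y · D_y⁻¹`
  have hent : ∀ (v : {v : InfinitePlace (Fp L) // v.IsReal}) (x y : Fin (n + n)),
      Matrix.fromBlocks ((k v).1 : Matrix _ _ ℂ) 0 0 ((k v).2 : Matrix _ _ ℂ)
          (signSplit (signVec (cmPlaceOver L) (entryD L e dV hdV dW hdW) (imagUnit L) v) x)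
          (signSplit (signVec (cmPlaceOver L) (entryD L e dV hdV dW hdW) (imagUnit L) v) y) =
        (((sqrtAbs (signVec (cmPlaceOver L) (entryD L e dV hdV dW hdW) (imagUnit L) v) x : ℝ) : ℂ)) *
          (((UnitaryGroup.archAt (Fp L) L (IsCMField.complexConj L) (n + n) (hermD L e dV hdV dW hdW) (cmPlaceOver L v) (cmPlaceOver_smul L v)
              (IsCMField.complexConj_ne_one L) (archKPlace L e dV hdV dW hdW v₀ u) :
              UnitaryGroup.archLocal L (n + n) (hermD L e dV hdV dW hdW) (cmPlaceOver L v)) : GL (Fin (n + n)) ℂ) : Matrix (Fin (n + n)) (Fin (n + n)) ℂ) x y *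
          ((((sqrtAbs (signVec (cmPlaceOver L) (entryD L e dV hdV dW hdW) (imagUnit L) v) y : ℝ) : ℂ))⁻¹) := fun v x y => by
    have h := congrArg (fun g : UForm (PosIdx (signVec (cmPlaceOver L) (entryD L e dV hdV dW hdW) (imagUnit L) v))
        (NegIdx (signVec (cmPlaceOver L) (entryD L e dV hdV dW hdW) (imagUnit L) v)) =>
          ((g : GL (PosIdx (signVec (cmPlaceOver L) (entryD L e dV hdV dW hdW) (imagUnit L) v) ⊕
              NegIdx (signVec (cmPlaceOver L) (entryD L e dV hdV dW hdW) (imagUnit L) v)) ℂ) :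
            Matrix (PosIdx (signVec (cmPlaceOver L) (entryD L e dV hdV dW hdW) (imagUnit L) v) ⊕
                NegIdx (signVec (cmPlaceOver L) (entryD L e dV hdV dW hdW) (imagUnit L) v))
              (PosIdx (signVec (cmPlaceOver L) (entryD L e dV hdV dW hdW) (imagUnit L) v) ⊕
                NegIdx (signVec (cmPlaceOver L) (entryD L e dV hdV dW hdW) (imagUnit L) v)) ℂ)
          (signSplit (signVec (cmPlaceOver L) (entryD L e dV hdV dW hdW) (imagUnit L) v) x)
          (signSplit (signVec (cmPlaceOver L) (entryD L e dV hdV dW hdW) (imagUnit L) v) y)) (hk v)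
    simp only [UForm.coe_kV, archUFormPi_apply, coe_archUForm, archPart_archToAdelic, Matrix.reindex_apply, Matrix.submatrix_apply,
      Equiv.symm_apply_apply, scaleConj_apply] at h
    exact h.symm
  -- `D ≠ 0`
  have hD0 : ∀ (v : {v : InfinitePlace (Fp L) // v.IsReal}) (x : Fin (n + n)),
      (((sqrtAbs (signVec (cmPlaceOver L) (entryD L e dV hdV dW hdW) (imagUnit L) v) x : ℝ) : ℂ)) ≠ 0 := fun v x =>
    Complex.ofReal_ne_zero.mpr (sqrtAbs_signVec_ne_zero (IsCMField.complexConj_ne_one L) (cmPlaceOver_smul L)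
      (complexConj_imagUnit L) (imagUnit_ne_zero L) (gramD_gram_realDiagonal_entry_ne_zero L e dV hdV dW hdW hdV0 hdW0) v x)
  -- the matrix `K` of the `v₀`-component and its three blocks: first copy `R = e-reindex (u ⊗ 1)`, second copy `1`, no cross entries
  set K := (((UnitaryGroup.archAt (Fp L) L (IsCMField.complexConj L) (n + n) (hermD L e dV hdV dW hdW) (cmPlaceOver L v₀) (cmPlaceOver_smul L v₀)
      (IsCMField.complexConj_ne_one L) (archKPlace L e dV hdV dW hdW v₀ u) :
      UnitaryGroup.archLocal L (n + n) (hermD L e dV hdV dW hdW) (cmPlaceOver L v₀)) : GL (Fin (n + n)) ℂ) : Matrix (Fin (n + n)) (Fin (n + n)) ℂ)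
    with hKdef
  have hK : K = Matrix.reindex (e₂ (n := n)) (e₂ (n := n))
      (Matrix.fromBlocks
        (Matrix.reindex e e
          ((((u : UnitaryGroup.archLocal L N (Matrix.diagonal dV) (cmPlaceOver L v₀)) : GL (Fin N) ℂ) : Matrix (Fin N) (Fin N) ℂ) ⊗ₖ
            (1 : Matrix (Fin M) (Fin M) ℂ)))
        0 0 1) := by
    rw [hKdef, coe_archAt_archKPlace]
    erw [UnitaryGroup.archAt_archSingle_self (Fp L) L (IsCMField.complexConj L) N (Matrix.diagonal dV) (IsCMField.complexConj_ne_one L)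
      (complexConj_smul_infinitePlace L) (cmPlaceOver L v₀) u]
  have hK11 : ∀ i i' : Fin n, K ((e₂ (n := n)) (Sum.inl i)) ((e₂ (n := n)) (Sum.inl i')) =
      Matrix.reindex e e
        ((((u : UnitaryGroup.archLocal L N (Matrix.diagonal dV) (cmPlaceOver L v₀)) : GL (Fin N) ℂ) : Matrix (Fin N) (Fin N) ℂ) ⊗ₖ
          (1 : Matrix (Fin M) (Fin M) ℂ)) i i' := fun i i' => by
    rw [hK, Matrix.reindex_apply, Matrix.submatrix_apply, Equiv.symm_apply_apply, Equiv.symm_apply_apply, Matrix.fromBlocks_apply₁₁]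
  have hK12 : ∀ i j : Fin n, K ((e₂ (n := n)) (Sum.inl i)) ((e₂ (n := n)) (Sum.inr j)) = 0 := fun i j => by
    rw [hK, Matrix.reindex_apply, Matrix.submatrix_apply, Equiv.symm_apply_apply, Equiv.symm_apply_apply, Matrix.fromBlocks_apply₁₂,
      Matrix.zero_apply]
  have hK21 : ∀ j i : Fin n, K ((e₂ (n := n)) (Sum.inr j)) ((e₂ (n := n)) (Sum.inl i)) = 0 := fun j i => by
    rw [hK, Matrix.reindex_apply, Matrix.submatrix_apply, Equiv.symm_apply_apply, Equiv.symm_apply_apply, Matrix.fromBlocks_apply₂₁,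
      Matrix.zero_apply]
  have hK22 : ∀ j j' : Fin n, K ((e₂ (n := n)) (Sum.inr j)) ((e₂ (n := n)) (Sum.inr j')) = (1 : Matrix (Fin n) (Fin n) ℂ) j j' := fun j j' => by
    rw [hK, Matrix.reindex_apply, Matrix.submatrix_apply, Equiv.symm_apply_apply, Equiv.symm_apply_apply, Matrix.fromBlocks_apply₂₂]
  -- the unitary `U₀` of the `v₀`-block and its entries
  set U₀ : Matrix.unitaryGroup (Fin (n + n)) ℂ :=
    reindexUnitary (signSplit (signVec (cmPlaceOver L) (entryD L e dV hdV dW hdW) (imagUnit L) v₀)) (blockU (conjU (k v₀).1, (k v₀).2))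
    with hU₀def
  have hU₀ : ∀ x y : Fin (n + n), (U₀ : Matrix (Fin (n + n)) (Fin (n + n)) ℂ) x y =
      if 0 < signVec (cmPlaceOver L) (entryD L e dV hdV dW hdW) (imagUnit L) v₀ x then
        (if 0 < signVec (cmPlaceOver L) (entryD L e dV hdV dW hdW) (imagUnit L) v₀ y then
          star ((((sqrtAbs (signVec (cmPlaceOver L) (entryD L e dV hdV dW hdW) (imagUnit L) v₀) x : ℝ) : ℂ)) * K x y *
            ((((sqrtAbs (signVec (cmPlaceOver L) (entryD L e dV hdV dW hdW) (imagUnit L) v₀) y : ℝ) : ℂ))⁻¹))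
        else 0)
      else
        (if 0 < signVec (cmPlaceOver L) (entryD L e dV hdV dW hdW) (imagUnit L) v₀ y then 0
        else (((sqrtAbs (signVec (cmPlaceOver L) (entryD L e dV hdV dW hdW) (imagUnit L) v₀) x : ℝ) : ℂ)) * K x y *
            ((((sqrtAbs (signVec (cmPlaceOver L) (entryD L e dV hdV dW hdW) (imagUnit L) v₀) y : ℝ) : ℂ))⁻¹)) := by
    intro x y
    rw [hU₀def, reindexUnitary_apply, coe_blockU, coe_conjU]
    by_cases hx : 0 < signVec (cmPlaceOver L) (entryD L e dV hdV dW hdW) (imagUnit L) v₀ x <;>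
      by_cases hy : 0 < signVec (cmPlaceOver L) (entryD L e dV hdV dW hdW) (imagUnit L) v₀ y
    · have hεx := Equiv.sumCompl_symm_apply_of_pos (p := fun j => 0 < signVec (cmPlaceOver L) (entryD L e dV hdV dW hdW) (imagUnit L) v₀ j)
        (a := x) hx
      have hεy := Equiv.sumCompl_symm_apply_of_pos (p := fun j => 0 < signVec (cmPlaceOver L) (entryD L e dV hdV dW hdW) (imagUnit L) v₀ j)
        (a := y) hy
      rw [if_pos hx, if_pos hy]
      erw [hεx, hεy]
      rw [Matrix.fromBlocks_apply₁₁, Matrix.map_apply]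
      have h := hent v₀ x y
      erw [hεx, hεy] at h
      rw [Matrix.fromBlocks_apply₁₁] at h
      rw [h]
    · have hεx := Equiv.sumCompl_symm_apply_of_pos (p := fun j => 0 < signVec (cmPlaceOver L) (entryD L e dV hdV dW hdW) (imagUnit L) v₀ j)
        (a := x) hx
      have hεy := Equiv.sumCompl_symm_apply_of_neg (p := fun j => 0 < signVec (cmPlaceOver L) (entryD L e dV hdV dW hdW) (imagUnit L) v₀ j)
        (a := y) hy
      rw [if_pos hx, if_neg hy]
      erw [hεx, hεy]
      rw [Matrix.fromBlocks_apply₁₂, Matrix.zero_apply]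
    · have hεx := Equiv.sumCompl_symm_apply_of_neg (p := fun j => 0 < signVec (cmPlaceOver L) (entryD L e dV hdV dW hdW) (imagUnit L) v₀ j)
        (a := x) hx
      have hεy := Equiv.sumCompl_symm_apply_of_pos (p := fun j => 0 < signVec (cmPlaceOver L) (entryD L e dV hdV dW hdW) (imagUnit L) v₀ j)
        (a := y) hy
      rw [if_neg hx, if_pos hy]
      erw [hεx, hεy]
      rw [Matrix.fromBlocks_apply₂₁, Matrix.zero_apply]
    · have hεx := Equiv.sumCompl_symm_apply_of_neg (p := fun j => 0 < signVec (cmPlaceOver L) (entryD L e dV hdV dW hdW) (imagUnit L) v₀ j)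
        (a := x) hx
      have hεy := Equiv.sumCompl_symm_apply_of_neg (p := fun j => 0 < signVec (cmPlaceOver L) (entryD L e dV hdV dW hdW) (imagUnit L) v₀ j)
        (a := y) hy
      rw [if_neg hx, if_neg hy]
      erw [hεx, hεy]
      rw [Matrix.fromBlocks_apply₂₂]
      have h := hent v₀ x y
      erw [hεx, hεy] at h
      rw [Matrix.fromBlocks_apply₂₂] at h
      rw [h]
  -- no cross-copy entries of `U₀`; second copy `1`
  have hU₀12 : ∀ i j : Fin n, (U₀ : Matrix (Fin (n + n)) (Fin (n + n)) ℂ) ((e₂ (n := n)) (Sum.inl i)) ((e₂ (n := n)) (Sum.inr j)) = 0 :=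
    fun i j => by
    rw [hU₀, hK12]
    split_ifs <;> simp
  have hU₀21 : ∀ j i : Fin n, (U₀ : Matrix (Fin (n + n)) (Fin (n + n)) ℂ) ((e₂ (n := n)) (Sum.inr j)) ((e₂ (n := n)) (Sum.inl i)) = 0 :=
    fun j i => by
    rw [hU₀, hK21]
    split_ifs <;> simp
  have hU₀22 : ∀ j j' : Fin n, (U₀ : Matrix (Fin (n + n)) (Fin (n + n)) ℂ) ((e₂ (n := n)) (Sum.inr j)) ((e₂ (n := n)) (Sum.inr j')) =
      (1 : Matrix (Fin n) (Fin n) ℂ) j j' := fun j j' => by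
    rw [hU₀, hK22]
    by_cases hjj : j = j'
    · subst hjj
      rw [Matrix.one_apply_eq, mul_one, mul_inv_cancel₀ (hD0 v₀ _), star_one]
      split_ifs <;> rfl
    · rw [Matrix.one_apply_ne hjj, mul_zero, zero_mul, star_zero]
      split_ifs <;> rfl
  -- the unitary `W` = the first-copy block of `U₀`
  let W : Matrix.unitaryGroup (Fin n) ℂ :=
    ⟨Matrix.of fun i i' : Fin n => (U₀ : Matrix (Fin (n + n)) (Fin (n + n)) ℂ) ((e₂ (n := n)) (Sum.inl i)) ((e₂ (n := n)) (Sum.inl i')),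
      submatrix_mem_unitaryGroup_of_apply_eq_zero U₀ (e₂ (n := n)) hU₀12⟩
  have hW : ∀ i i' : Fin n, (W : Matrix (Fin n) (Fin n) ℂ) i i' =
      (U₀ : Matrix (Fin (n + n)) (Fin (n + n)) ℂ) ((e₂ (n := n)) (Sum.inl i)) ((e₂ (n := n)) (Sum.inl i')) := fun i i' => rfl
  refine ⟨W, fun i i' => ?_, ?_⟩
  · -- the entries of `W`
    rw [hW, hU₀, signVec_doubled_inl, signVec_doubled_inl, hK11]
    simp only [sqrtAbs, signVec_doubled_inl]
    by_cases hi : 0 < signVec (cmPlaceOver L) (cmGramEntry L e dV hdV dW hdW) (imagUnit L) v₀ i <;>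
      by_cases hi' : 0 < signVec (cmPlaceOver L) (cmGramEntry L e dV hdV dW hdW) (imagUnit L) v₀ i'
    · rw [if_pos hi, if_pos hi', if_pos hi]
    · rw [if_pos hi, if_neg hi', if_pos hi, (hblk i i' hi hi').1, mul_zero, zero_mul, star_zero]
    · rw [if_neg hi, if_pos hi', if_neg hi, (hblk i' i hi' hi).2, mul_zero, zero_mul]
    · rw [if_neg hi, if_neg hi', if_neg hi]
  · -- the phase map
    rw [show MpS.proj (sectionD L e dV hdV hdV0 dW hdW hdW0 (archKPlace L e dV hdV dW hdW v₀ u)) = _ from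
      proj_archWeilSectionS_eq_realifySp_placeBlock L (IsCMField.complexConj L) (n + n) (IsCMField.complexConj_ne_one L) (cmPlaceOver L)
        (cmPlaceOver_smul L) (cmPlaceOver_comap L) (entryD L e dV hdV dW hdW)
        (gramD_gram_realDiagonal_entry_ne_zero L e dV hdV dW hdW hdV0 hdW0) (gramD_eq_diagonal_cm L e dV hdV dW hdW)
        (J := hermD L e dV hdV dW hdW) rfl (complexConj_imagUnit L) (imagUnit_ne_zero L) (archKPlace L e dV hdV dW hdW v₀ u)
        (fun v => (k v).1) (fun v => (k v).2) (fun v => by rw [Prod.mk.eta]; exact hk v)]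
    refine congrArg _ (congrArg placeBlock (funext fun v => ?_))
    by_cases hv : v = v₀
    · subst hv
      rw [Pi.mulSingle_eq_same]
      show U₀ = _
      apply Subtype.ext
      refine Matrix.ext fun x y => ?_
      obtain ⟨s, rfl⟩ := (e₂ (n := n)).surjective x
      obtain ⟨t, rfl⟩ := (e₂ (n := n)).surjective y
      rw [show ((reindexUnitary (e₂ (n := n)).symm (blockU (W, 1)) : Matrix.unitaryGroup (Fin (n + n)) ℂ) :
          Matrix (Fin (n + n)) (Fin (n + n)) ℂ) ((e₂ (n := n)) s) ((e₂ (n := n)) t) =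
          Matrix.fromBlocks (W : Matrix (Fin n) (Fin n) ℂ) 0 0 ((1 : Matrix.unitaryGroup (Fin n) ℂ) : Matrix (Fin n) (Fin n) ℂ) s t from by
        rw [reindexUnitary_apply, coe_blockU, Equiv.symm_apply_apply, Equiv.symm_apply_apply]]
      rcases s with i | j <;> rcases t with i' | j'
      · rw [Matrix.fromBlocks_apply₁₁, hW]
      · rw [Matrix.fromBlocks_apply₁₂, Matrix.zero_apply, hU₀12]
      · rw [Matrix.fromBlocks_apply₂₁, Matrix.zero_apply, hU₀21]
      · rw [Matrix.fromBlocks_apply₂₂, hU₀22, OneMemClass.coe_one]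
    · rw [Pi.mulSingle_eq_of_ne hv]
      -- at `v ≠ v₀` the component is `1`: `(k_{v₀,u})_{w(v)} = 1`
      have hne : cmPlaceOver L v ≠ cmPlaceOver L v₀ := fun h => hv (Subtype.ext (by
        rw [← cmPlaceOver_comap L v, ← cmPlaceOver_comap L v₀, h]))
      have hG : (((UnitaryGroup.archAt (Fp L) L (IsCMField.complexConj L) (n + n) (hermD L e dV hdV dW hdW) (cmPlaceOver L v) (cmPlaceOver_smul L v)
          (IsCMField.complexConj_ne_one L) (archKPlace L e dV hdV dW hdW v₀ u) :
          UnitaryGroup.archLocal L (n + n) (hermD L e dV hdV dW hdW) (cmPlaceOver L v)) : GL (Fin (n + n)) ℂ) : Matrix (Fin (n + n)) (Fin (n + n)) ℂ) = 1 := by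
        rw [coe_archAt_archKPlace]
        erw [UnitaryGroup.archAt_archSingle_of_ne (Fp L) L (IsCMField.complexConj L) N (Matrix.diagonal dV) (IsCMField.complexConj_ne_one L)
          (complexConj_smul_infinitePlace L) (cmPlaceOver L v₀) hne u]
        simp only [OneMemClass.coe_one, Units.val_one, Matrix.one_kronecker_one, Matrix.reindex_apply, Matrix.submatrix_one_equiv,
          Matrix.fromBlocks_one]
      apply Subtype.ext
      refine Matrix.ext fun x y => ?_
      rw [reindexUnitary_apply, coe_blockU, coe_conjU, OneMemClass.coe_one]
      have h := hent v x y
      rw [hG] at h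
      rcases hx : signSplit (signVec (cmPlaceOver L) (entryD L e dV hdV dW hdW) (imagUnit L) v) x with p | q <;>
        rcases hy : signSplit (signVec (cmPlaceOver L) (entryD L e dV hdV dW hdW) (imagUnit L) v) y with p' | q'
      · rw [hx, hy, Matrix.fromBlocks_apply₁₁] at h
        rw [Matrix.fromBlocks_apply₁₁, Matrix.map_apply, h]
        by_cases hxy : x = y
        · subst hxy; rw [Matrix.one_apply_eq, mul_one, mul_inv_cancel₀ (hD0 v _), star_one]
        · rw [Matrix.one_apply_ne hxy, mul_zero, zero_mul, star_zero]
      · have hx' : x = p.1 := ((Equiv.symm_apply_eq _).mp hx).trans (Equiv.sumCompl_apply_inl p)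
        have hy' : y = q'.1 := ((Equiv.symm_apply_eq _).mp hy).trans (Equiv.sumCompl_apply_inr q')
        have hxy : x ≠ y := fun hxy => q'.2 (hy' ▸ hxy ▸ hx' ▸ p.2)
        rw [Matrix.fromBlocks_apply₁₂, Matrix.zero_apply, Matrix.one_apply_ne hxy]
      · have hx' : x = q.1 := ((Equiv.symm_apply_eq _).mp hx).trans (Equiv.sumCompl_apply_inr q)
        have hy' : y = p'.1 := ((Equiv.symm_apply_eq _).mp hy).trans (Equiv.sumCompl_apply_inl p')
        have hxy : x ≠ y := fun hxy => q.2 (hx' ▸ hxy ▸ hy' ▸ p'.2)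
        rw [Matrix.fromBlocks_apply₂₁, Matrix.zero_apply, Matrix.one_apply_ne hxy]
      · rw [hx, hy, Matrix.fromBlocks_apply₂₂] at h
        rw [Matrix.fromBlocks_apply₂₂, h]
        by_cases hxy : x = y
        · subst hxy; rw [Matrix.one_apply_eq, mul_one, mul_inv_cancel₀ (hD0 v _)]
        · rw [Matrix.one_apply_ne hxy, mul_zero, zero_mul]

/-- **THE OPERATOR OF FOLLAND'S SECTION AT `k_{v₀,u}`, `u` SIGN-BLOCK-DIAGONAL**: with `W` as in
`exists_proj_sectionD_archKPlace_eq_placeBlock_of_blockDiag`, `sectionD k_{v₀,u}` acts on `𝓢(ℝ^{Fin (n+n) × places})` by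
`vac (sectionD k_{v₀,u}) • μ₀(placeBlock (Pi.mulSingle v₀ ((W ⊕ 1)^{e₂⁻¹})))` (★ `MpS.apply_eq_vac_smul_unitaryOpPi`) — the hypothesis `hS` of ★ T2 up to the
frame transport of ★ β-II, at an indefinite place. [cite: Folland1989, §4.2 Prop. (4.39)] [cite: KonnoKonno2007, Lemma 5.2 p. 73] -/
theorem exists_sectionD_archKPlace_apply_of_blockDiag (u : UnitaryGroup.archLocal L N (Matrix.diagonal dV) (cmPlaceOver L v₀))
    (hblk : ∀ k k' : Fin n, 0 < signVec (cmPlaceOver L) (cmGramEntry L e dV hdV dW hdW) (imagUnit L) v₀ k →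
      ¬ 0 < signVec (cmPlaceOver L) (cmGramEntry L e dV hdV dW hdW) (imagUnit L) v₀ k' →
      Matrix.reindex e e
          ((((u : UnitaryGroup.archLocal L N (Matrix.diagonal dV) (cmPlaceOver L v₀)) : GL (Fin N) ℂ) : Matrix (Fin N) (Fin N) ℂ) ⊗ₖ
            (1 : Matrix (Fin M) (Fin M) ℂ)) k k' = 0 ∧
      Matrix.reindex e e
          ((((u : UnitaryGroup.archLocal L N (Matrix.diagonal dV) (cmPlaceOver L v₀)) : GL (Fin N) ℂ) : Matrix (Fin N) (Fin N) ℂ) ⊗ₖ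
            (1 : Matrix (Fin M) (Fin M) ℂ)) k' k = 0) :
    ∃ W : Matrix.unitaryGroup (Fin n) ℂ,
      (∀ i i' : Fin n, (W : Matrix (Fin n) (Fin n) ℂ) i i' =
        if 0 < signVec (cmPlaceOver L) (cmGramEntry L e dV hdV dW hdW) (imagUnit L) v₀ i then
          star ((((sqrtAbs (signVec (cmPlaceOver L) (cmGramEntry L e dV hdV dW hdW) (imagUnit L) v₀) i : ℝ) : ℂ)) *
            Matrix.reindex e e
              ((((u : UnitaryGroup.archLocal L N (Matrix.diagonal dV) (cmPlaceOver L v₀)) : GL (Fin N) ℂ) : Matrix (Fin N) (Fin N) ℂ) ⊗ₖ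
                (1 : Matrix (Fin M) (Fin M) ℂ)) i i' *
            (((sqrtAbs (signVec (cmPlaceOver L) (cmGramEntry L e dV hdV dW hdW) (imagUnit L) v₀) i' : ℝ) : ℂ))⁻¹)
        else
          (((sqrtAbs (signVec (cmPlaceOver L) (cmGramEntry L e dV hdV dW hdW) (imagUnit L) v₀) i : ℝ) : ℂ)) *
            Matrix.reindex e e
              ((((u : UnitaryGroup.archLocal L N (Matrix.diagonal dV) (cmPlaceOver L v₀)) : GL (Fin N) ℂ) : Matrix (Fin N) (Fin N) ℂ) ⊗ₖ
                (1 : Matrix (Fin M) (Fin M) ℂ)) i i' *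
            (((sqrtAbs (signVec (cmPlaceOver L) (cmGramEntry L e dV hdV dW hdW) (imagUnit L) v₀) i' : ℝ) : ℂ))⁻¹) ∧
      ∀ f : SchwartzMap ((Fin (n + n) × {v : InfinitePlace (Fp L) // v.IsReal}) → ℝ) ℂ,
        (sectionD L e dV hdV hdV0 dW hdW hdW0 (archKPlace L e dV hdV dW hdW v₀ u)).1.2 f =
          MpS.vac (sectionD L e dV hdV hdV0 dW hdW hdW0 (archKPlace L e dV hdV dW hdW v₀ u)) •
            unitaryOpPi (placeBlock (Pi.mulSingle v₀ (reindexUnitary (e₂ (n := n)).symm (blockU (W, 1))))) f := by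
  obtain ⟨W, hW, hproj⟩ := exists_proj_sectionD_archKPlace_eq_placeBlock_of_blockDiag L e dV hdV hdV0 dW hdW hdW0 v₀ u hblk
  exact ⟨W, hW, fun f => MpS.apply_eq_vac_smul_unitaryOpPi hproj f⟩

end Literature.NumberTheory.GelbartRogawski1991.GRConstruction

end
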